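import Literature.AlgebraicGeometry.Motives.AbelianVarietyLieCharpolyBaseChange
import Mathlib.NumberTheory.NumberField.InfinitePlace.Embeddings
import HarnessLib

/-!
# The Kottwitz (determinant ∕ signature) condition at a field point is invariant along field embeddings
# ([Kottwitz 1992] §5 p. 390; [RSZ 2020] §4.1; [Shimura 1998] §8.5; [Görtz–Wedhorn I] Rem. 6.12)

Topic `Literature/AlgebraicGeometry/Motives`; namespace `Literature.AlgebraicGeometry.Motives.AbelianVariety` (continues ★
`AbelianVarietyLieCharpolyBaseChange`: `char(T_e^*(u_L)) = char(T_e^*(u)) ⊗ L`, `char(Lie(σu)) = σ(char(Lie u))`).  THEOREMS ONLY (no definition,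
no named fact, no `instance`, no notation, no `sorry`).  Cell `hodgecm-mathlib` (D-0151), FLOOR 0, P6 «MOD programme», `stub_RGD` ledger row
(vi)(U1) piece **(U1-c)** — under LEAD ruling «M-17m′» (door (E) EMBEDDING, 2026-09-01 21:14:54Z) the consumer E6∕(S7) reads the Kottwitz condition
POINTWISE at `Ω`-points of the record curve, known at `ℂ`-points from the analytic side; this file is the transfer «Kottwitz at `y ≫ Spec σ` ⇔
Kottwitz at `y`» along a field embedding `σ : Ω ↪ ℂ` (★ (S-H-E) `PadicAlgClosureEmbedsComplex`), in A-p17 (g26)՚s frame-agnostic ROOT FORM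
`charpoly = ∏ i ∈ s, (X − C (c i)) ^ m i`, together with the re-indexing of embeddings `Hom(F, Ω) ≃ Hom(F, ℂ)` along `σ`.
`--supports stmt-HodgeConjecture-24832`, count-neutral: HC_CM is proved only modulo the 2 remaining named inputs (hLiu418 24832, h413 24833) until
rung 0 closes; nothing here is about HC.

THE PRINT ([Kottwitz1992] §5 p. 390: the determinant condition «`char(i(a) | Lie A) = ∏_φ (T − φ(a))^{r_φ}`»; [RapoportSmithlingZhang2020Diagonal]
§4.1 p. 15 and (3.11)∕(3.14) p. 13 (Kottwitz condition of signature `(1, n−1)`), (4.6) p. 16 (the per-place count); [Shimura1998] §8.5 p. 89 L1 «`S(ι(ξ)^σ)` has the characteristic roots `ξ^{φ_1σ}, …`»;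
[GortzWedhorn2020] Rem. 6.12 (2)–(3): tangent∕cotangent spaces commute with field extension).  For an abelian variety `A ∕ K`, `u ∈ End(A)` and a
field homomorphism `σ : K → L`, `char(T_e^*(σu) | T_e^* σA) = σ(char(T_e^*(u)))` (★) and `σ : K[X] → L[X]` is injective, so
`char(T_e^*(σu)) = ∏ (X − σ(c_i))^{m_i} ⇔ char(T_e^*(u)) = ∏ (X − c_i)^{m_i}`; same for `Lie`.  For a number field `F` and algebraically closed
fields `Ω →σ Ω′` of characteristic `0`, `τ ↦ σ ∘ τ : Hom(F, Ω) → Hom(F, Ω′)` is a bijection (injective; both sides have `[F : ℚ]` elements — Mathlib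
`NumberField.Embeddings.card`), so signature-indexed products and counts over `Hom(F, Ω′)` re-index over `Hom(F, Ω)`.

* §1 `map_prod_X_sub_C_pow` (polynomial algebra); §2 `charpoly_cotangentMap_baseChangeAlong` (the cotangent twin of ★ `charpoly_lieMap_baseChangeAlong`),
  **`charpoly_cotangentMap_eq_prod_iff_baseChangeAlong`**, **`charpoly_lieMap_eq_prod_iff_baseChangeAlong`**, `charpoly_cotangentMap_eq_prod_iff_baseChange`
  (algebra form), `forall_charpoly_cotangentMap_eq_prod_iff_baseChangeAlong` (a family of endomorphisms, e.g. `a ↦ ι(a)`);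
* §3 **`bijective_comp_embeddings`** (`Hom(F, Ω) ≃ Hom(F, Ω′)` along `σ`), `prod_embeddings_comp`, `sum_embeddings_comp` (re-indexing of signature
  products ∕ counts); §4 HEAD **`charpoly_cotangentMap_eq_prod_embeddings_iff_baseChangeAlong`** — Kottwitz of signature `r : Hom(F, Ω′) → ℕ` for
  `σA` at `a` ⇔ Kottwitz of signature `r ∘ (σ ∘ ·)` for `A` at `a`, roots `τ(a) ∈ Ω` (`F → Ω` through a chosen `j : F →+* K`-free form: roots given
  as `τ a` for `τ : F →+* K`).

## References
* [Kottwitz1992] R. Kottwitz, *Points on some Shimura varieties over finite fields*, JAMS 5 (1992), §5 p. 390 (determinant condition).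
* [RapoportSmithlingZhang2020Diagonal] M. Rapoport, B. Smithling, W. Zhang, *Arithmetic diagonal cycles on unitary Shimura varieties*, Compos. Math.
  156 (2020), §4.1 (p. 15), (3.11)∕Remark 3.6 (i) (3.14) (p. 13), (4.6) (p. 16).
* [Shimura1998] G. Shimura, *Abelian Varieties with Complex Multiplication and Modular Functions* (1998), §8.5 p. 89 L1.
* [GortzWedhorn2020] U. Görtz, T. Wedhorn, *Algebraic Geometry I*, 2nd ed. (2020), Remark 6.3 (3), Remark 6.12 (2)–(3).
-/

set_option autoImplicit false

noncomputable section

universe u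

open CategoryTheory Polynomial

namespace Literature.AlgebraicGeometry.Motives

namespace AbelianVariety

/-! ## §1 Polynomial algebra: a product of powers of linear factors maps factorwise -/

/-- `(∏ (X − c_i)^{m_i})` maps to `∏ (X − f c_i)^{m_i}` under a ring homomorphism `f`. [cite: GortzWedhorn2020, Remark 6.12 (2)–(3)] -/
theorem map_prod_X_sub_C_pow {R S : Type*} [CommRing R] [CommRing S] (f : R →+* S) {ι : Type*} (s : Finset ι) (c : ι → R) (m : ι → ℕ) :
    (∏ i ∈ s, (Polynomial.X - Polynomial.C (c i)) ^ m i).map f = ∏ i ∈ s, (Polynomial.X - Polynomial.C (f (c i))) ^ m i := by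
  rw [Polynomial.map_prod]
  refine Finset.prod_congr rfl fun i _ => ?_
  rw [Polynomial.map_pow, Polynomial.map_sub, Polynomial.map_X, Polynomial.map_C]

/-! ## §2 Kottwitz in root form is invariant along a field embedding -/

section Along

variable {K : Type u} [Field K] {L : Type u} [Field L] {A : AbelianVariety K}

/-- **`char(T_e^*(σu) | T_e^* σA) = σ(char(T_e^*(u) | T_e^* A))`** — the cotangent twin of ★ `charpoly_lieMap_baseChangeAlong` (★
`charpoly_cotangentMap_baseChange` for the algebra `AlongHom L σ`). [cite: GortzWedhorn2020, Remark 6.12 (2)–(3)] [cite: Shimura1998, §8.5 p. 89 L1] -/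
theorem charpoly_cotangentMap_baseChangeAlong (σ : K →+* L) (u : A ⟶ A) :
    (cotangentMap (A.baseChangeAlong σ) (Hom.baseChangeAlong σ u)).charpoly = (cotangentMap A u).charpoly.map σ :=
  charpoly_cotangentMap_baseChange (AlongHom L σ) u

/-- **KOTTWITZ IN ROOT FORM IS INVARIANT ALONG A FIELD EMBEDDING (cotangent space)**: for `σ : K → L`, roots `c : ι → K` and multiplicities `m`,
`char(T_e^*(σu)) = ∏ (X − σ c_i)^{m_i}` iff `char(T_e^*(u)) = ∏ (X − c_i)^{m_i}` (★ + injectivity of `K[X] → L[X]`).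
[cite: Kottwitz1992, §5 p. 390] [cite: GortzWedhorn2020, Remark 6.12 (2)–(3)] -/
theorem charpoly_cotangentMap_eq_prod_iff_baseChangeAlong (σ : K →+* L) (u : A ⟶ A) {ι : Type*} (s : Finset ι) (c : ι → K) (m : ι → ℕ) :
    (cotangentMap (A.baseChangeAlong σ) (Hom.baseChangeAlong σ u)).charpoly = ∏ i ∈ s, (Polynomial.X - Polynomial.C (σ (c i))) ^ m i ↔
      (cotangentMap A u).charpoly = ∏ i ∈ s, (Polynomial.X - Polynomial.C (c i)) ^ m i := by
  rw [charpoly_cotangentMap_baseChangeAlong, ← map_prod_X_sub_C_pow σ, (Polynomial.map_injective σ σ.injective).eq_iff]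

/-- **KOTTWITZ IN ROOT FORM IS INVARIANT ALONG A FIELD EMBEDDING (Lie algebra)**. [cite: Kottwitz1992, §5 p. 390] [cite: Shimura1998, §8.5 p. 89 L1] -/
theorem charpoly_lieMap_eq_prod_iff_baseChangeAlong (σ : K →+* L) (u : A ⟶ A) {ι : Type*} (s : Finset ι) (c : ι → K) (m : ι → ℕ) :
    (lieMap (A.baseChangeAlong σ) (Hom.baseChangeAlong σ u)).charpoly = ∏ i ∈ s, (Polynomial.X - Polynomial.C (σ (c i))) ^ m i ↔
      (lieMap A u).charpoly = ∏ i ∈ s, (Polynomial.X - Polynomial.C (c i)) ^ m i := by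
  rw [charpoly_lieMap_baseChangeAlong, ← map_prod_X_sub_C_pow σ, (Polynomial.map_injective σ σ.injective).eq_iff]

/-- **A FAMILY OF ENDOMORPHISMS** (e.g. `a ↦ ι(a)` for a ring action): Kottwitz for every `a` on `σA` iff on `A`. [cite: Kottwitz1992, §5 p. 390]
[cite: RapoportSmithlingZhang2020Diagonal, §4.1 (p. 15) and Remark 3.6 (i) (3.14) (p. 13)] -/
theorem forall_charpoly_cotangentMap_eq_prod_iff_baseChangeAlong (σ : K →+* L) {O : Type*} (u : O → (A ⟶ A)) {ι : Type*} (s : Finset ι)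
    (c : O → ι → K) (m : ι → ℕ) :
    (∀ a, (cotangentMap (A.baseChangeAlong σ) (Hom.baseChangeAlong σ (u a))).charpoly = ∏ i ∈ s, (Polynomial.X - Polynomial.C (σ (c a i))) ^ m i) ↔
      ∀ a, (cotangentMap A (u a)).charpoly = ∏ i ∈ s, (Polynomial.X - Polynomial.C (c a i)) ^ m i :=
  forall_congr' fun a => charpoly_cotangentMap_eq_prod_iff_baseChangeAlong σ (u a) s (c a) m

end Along

section Algebra

variable {K : Type u} [Field K] (L : Type u) [Field L] [Algebra K L] {A : AbelianVariety K}

/-- **Algebra form**: for a field extension `L ∕ K`, `char(T_e^*(u_L)) = ∏ (X − c_i)^{m_i}` in `L[X]` (roots read through `algebraMap`) iff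
`char(T_e^*(u)) = ∏ (X − c_i)^{m_i}` in `K[X]`. [cite: Kottwitz1992, §5 p. 390] [cite: GortzWedhorn2020, Remark 6.12 (2)–(3)] -/
theorem charpoly_cotangentMap_eq_prod_iff_baseChange (u : A ⟶ A) {ι : Type*} (s : Finset ι) (c : ι → K) (m : ι → ℕ) :
    (cotangentMap (A.baseChange L) (Hom.baseChange L u)).charpoly = ∏ i ∈ s, (Polynomial.X - Polynomial.C (algebraMap K L (c i))) ^ m i ↔
      (cotangentMap A u).charpoly = ∏ i ∈ s, (Polynomial.X - Polynomial.C (c i)) ^ m i := by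
  rw [charpoly_cotangentMap_baseChange, ← map_prod_X_sub_C_pow (algebraMap K L),
    (Polynomial.map_injective (algebraMap K L) (algebraMap K L).injective).eq_iff]

end Algebra

/-! ## §3 Re-indexing embeddings of a number field along `σ : Ω → Ω′` -/

section Embeddings

variable (F : Type*) [Field F] [NumberField F] {Ω : Type*} [Field Ω] [CharZero Ω] [IsAlgClosed Ω] {Ω' : Type*} [Field Ω'] [CharZero Ω']
  [IsAlgClosed Ω'] (σ : Ω →+* Ω')

/-- **`τ ↦ σ ∘ τ : Hom(F, Ω) → Hom(F, Ω′)` is a bijection** for a number field `F` and algebraically closed fields `Ω`, `Ω′` of characteristic `0`: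
injective since `σ` is, and both sides have `[F : ℚ]` elements (Mathlib `NumberField.Embeddings.card`). [cite: Shimura1998, §8.5 p. 89 L1] -/
theorem bijective_comp_embeddings : Function.Bijective fun τ : F →+* Ω => σ.comp τ := by
  have hinj : Function.Injective fun τ : F →+* Ω => σ.comp τ := fun τ₁ τ₂ h =>
    RingHom.ext fun x => σ.injective (by simpa using RingHom.congr_fun h x)
  exact (Fintype.bijective_iff_injective_and_card _).2
    ⟨hinj, by rw [NumberField.Embeddings.card F Ω, NumberField.Embeddings.card F Ω']⟩

/-- **Signature products re-index along `σ`**: `∏_{τ′ : F → Ω′} g τ′ = ∏_{τ : F → Ω} g (σ ∘ τ)`. [cite: Kottwitz1992, §5 p. 390] -/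
theorem prod_embeddings_comp {M : Type*} [CommMonoid M] (g : (F →+* Ω') → M) :
    ∏ τ : F →+* Ω, g (σ.comp τ) = ∏ τ' : F →+* Ω', g τ' :=
  Fintype.prod_bijective _ (bijective_comp_embeddings F σ) _ _ fun _ => rfl

/-- **Signature counts re-index along `σ`**: `∑_{τ′ : F → Ω′} g τ′ = ∑_{τ : F → Ω} g (σ ∘ τ)`. [cite: RapoportSmithlingZhang2020Diagonal, §4.1 (4.6) (p. 16)] -/
theorem sum_embeddings_comp {M : Type*} [AddCommMonoid M] (g : (F →+* Ω') → M) :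
    ∑ τ : F →+* Ω, g (σ.comp τ) = ∑ τ' : F →+* Ω', g τ' :=
  Fintype.sum_bijective _ (bijective_comp_embeddings F σ) _ _ fun _ => rfl

end Embeddings

/-! ## §4 The head: Kottwitz of signature `r` at `y ≫ Spec σ` ⇔ Kottwitz of signature `r ∘ (σ ∘ ·)` at `y` -/

section Head

variable {F : Type} [Field F] [NumberField F] {Ω : Type u} [Field Ω] [CharZero Ω] [IsAlgClosed Ω] {Ω' : Type u} [Field Ω'] [CharZero Ω']
  [IsAlgClosed Ω'] (σ : Ω →+* Ω') {A : AbelianVariety Ω}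

/-- **KOTTWITZ OF SIGNATURE `r` ALONG `σ : Ω ↪ Ω′`** ([Kottwitz1992] §5 p. 390; [RapoportSmithlingZhang2020Diagonal] §4.1): for `A ∕ Ω`, `u ∈ End(A)`, an
embedding `j : F → Ω` of the number field `F` acting through `a ∈ F` with roots `τ(a)`, and a signature `r : Hom(F, Ω′) → ℕ`:
`char(T_e^*(σu) | T_e^* σA) = ∏_{τ′ : F → Ω′} (X − τ′(a))^{r τ′}` iff `char(T_e^*(u) | T_e^* A) = ∏_{τ : F → Ω} (X − τ(a))^{r (σ ∘ τ)}` — the door-(E)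
transfer «Kottwitz at the `ℂ`-point over `y` ⇔ Kottwitz at the `Ω`-point `y`». [cite: Kottwitz1992, §5 p. 390] [cite: RapoportSmithlingZhang2020Diagonal, §4.1 (p. 15) and Remark 3.6 (i) (3.14) (p. 13)]
[cite: Shimura1998, §8.5 p. 89 L1] -/
theorem charpoly_cotangentMap_eq_prod_embeddings_iff_baseChangeAlong (u : A ⟶ A) (a : F) (r : (F →+* Ω') → ℕ) :
    (cotangentMap (A.baseChangeAlong σ) (Hom.baseChangeAlong σ u)).charpoly = ∏ τ' : F →+* Ω', (Polynomial.X - Polynomial.C (τ' a)) ^ r τ' ↔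
      (cotangentMap A u).charpoly = ∏ τ : F →+* Ω, (Polynomial.X - Polynomial.C (τ a)) ^ r (σ.comp τ) := by
  rw [← prod_embeddings_comp F σ (fun τ' : F →+* Ω' => (Polynomial.X - Polynomial.C (τ' a)) ^ r τ'),
    ← charpoly_cotangentMap_eq_prod_iff_baseChangeAlong σ u Finset.univ (fun τ : F →+* Ω => τ a) (fun τ => r (σ.comp τ))]
  simp only [RingHom.coe_comp, Function.comp_apply]

/-- The same for the Lie algebra. [cite: Kottwitz1992, §5 p. 390] [cite: Shimura1998, §8.5 p. 89 L1] -/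
theorem charpoly_lieMap_eq_prod_embeddings_iff_baseChangeAlong (u : A ⟶ A) (a : F) (r : (F →+* Ω') → ℕ) :
    (lieMap (A.baseChangeAlong σ) (Hom.baseChangeAlong σ u)).charpoly = ∏ τ' : F →+* Ω', (Polynomial.X - Polynomial.C (τ' a)) ^ r τ' ↔
      (lieMap A u).charpoly = ∏ τ : F →+* Ω, (Polynomial.X - Polynomial.C (τ a)) ^ r (σ.comp τ) := by
  rw [← prod_embeddings_comp F σ (fun τ' : F →+* Ω' => (Polynomial.X - Polynomial.C (τ' a)) ^ r τ'),
    ← charpoly_lieMap_eq_prod_iff_baseChangeAlong σ u Finset.univ (fun τ : F →+* Ω => τ a) (fun τ => r (σ.comp τ))]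
  simp only [RingHom.coe_comp, Function.comp_apply]

end Head

end AbelianVariety

end Literature.AlgebraicGeometry.Motives

end
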